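import Summits.CriticalPhenomena.PercolationContinuityZ3.Theses.PercNearOneGluing
import Literature.Probability.Percolation.PercolationEvents
import HarnessLib.Audit
import Summits.CriticalPhenomena.PercolationContinuityZ3.Theorems.PercNearOneGluingNearOneGluingVariants2374

/-! TTRL-lite variant V2413 of stmt-CriticalPhenomena-4574

(`stub_shorteningStep` of line `kn_shortening_induction`, move `specialise+small_case`:
`n := 3` fixed and `A.card = 1`).  This variant is an instance of the already-landed sibling
variant V2374 (`n ≤ 3`, any `A`, `stub_shorteningStep_var2374`) at `n = 3`; the extra hypothesis
`A.card = 1` is simply discarded.  (Mathematically: on three vertices the glued pair `s(v,x)` is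
almost surely open under `prodBernoulli (w[s(v,x) ↦ 1])`, so `μ(x ↔ z) ≤ μ(v ↔ z)` for every `z`,
and a case analysis on `b` closes the Kozma–Nitzan shortening inequality; see the docstring of
V2374.)  No new definitions, no named facts, the induction hypothesis is not used. -/

namespace Summit.CriticalPhenomena.PercolationContinuityZ3.Theorems

open MeasureTheory Set Literature.Probability.LatticeModels Literature.Probability.Percolation
open scoped Classical BigOperators

/-- TTRL-lite variant V2413 of `stub_shorteningStep` (stmt-CriticalPhenomena-4574, Kozma–Nitzan
Conjecture 6 with the induction hypothesis displayed): the shortening step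
`μ(⋃ a ∈ A, v ↔ a) · μ(a₀ ↔ b) ≤ μ(v ↔ b)` for the glued measure `μ = prodBernoulli (w[s(v,x) ↦ 1])`
on exactly three vertices (`Fin 3`) with `A.card = 1`.  Immediate from the sibling variant
`stub_shorteningStep_var2374` (case `n ≤ 3`, any `A`) specialised to `n = 3`. -/
theorem stub_shorteningStep_var2413 : ∀ (w : Sym2 (Fin 3) → unitInterval) (A : Finset (Fin 3)) (b v x a₀ : Fin 3), A.card = 1 → v ∉ A → v ≠ x → w s(v, x) = 0 → a₀ ∈ A → (∀ a ∈ A, (prodBernoulli w).real (openConn a₀ b) ≤ (prodBernoulli w).real (openConn a b)) → (∀ w' : Sym2 (Fin 3) → unitInterval, (∀ e, w e = 0 → w' e = 0) → ∀ (A' : Finset (Fin 3)) (o' b' : Fin 3) (t : ℝ), (∀ a ∈ A', t ≤ (prodBernoulli w').real (openConn a b')) → (prodBernoulli w').real (⋃ a ∈ A', openConn o' a) * t ≤ (prodBernoulli w').real (openConn o' b')) → (prodBernoulli (Function.update w s(v, x) 1)).real (⋃ a ∈ A, openConn v a) * (prodBernoulli (Function.update w s(v, x) 1)).real (openConn a₀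 b) ≤ (prodBernoulli (Function.update w s(v, x) 1)).real (openConn v b) := by
  intro w A b v x a₀ _hcard
  exact stub_shorteningStep_var2374 3 w A b v x a₀ le_rfl

end Summit.CriticalPhenomena.PercolationContinuityZ3.Theorems
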